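import Summits.Ventures.Crystal3D.LocalLP.ContactBridge
import HarnessLib

/-!
# Defect density bound: under-coordinated balls are paid for by the contact deficiency

HONEST FRAMING. Part of the venture `Summits/Ventures/Crystal3D` (cells `pub-crystal3d`,
`crystal3d-full`). A counting lemma for unit packings in `ℝ³`; nothing about three-dimensional
crystallization is claimed.

**Theorem** (`defectDensity_le`; statement (C2) of the cell `crystal3d-full`, HOME/cf-p1/ROUTE.md
§47–§49, planner sketch HOME/cf-p1/route/bc/TwoShellFoothold.lean). For every unit packing
`x : Fin N → ℝ³`: `#{i | coordination x i < 12} + 2·numContacts x ≤ 12·N` — every ball with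
fewer than twelve contacts contributes at least one unit to `12N − 2C(x) = Σ_i (12 − deg i)`.
Uses only the kissing-number bound `coordination_le_twelve` (tree theorem, `LocalLP/ContactBridge`)
and the handshake `sum_coordination_eq`.  Real form: `#{deg < 12} ≤ 2(6N − C(x))`
(`defectDensity_le_real`) — the first VOLUME-type lower bound of the venture (defective balls cost
deficiency proportional to their number).

WHAT THIS IS NOT: a statement about which balls are defective in a ground state; rung F-C1 of the
cell is not moved by a counting lemma.
-/

namespace Summit.Ventures.Crystal3D

open Finset

/-- **Defect density bound**: balls with fewer than twelve contacts are paid for by the contact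
deficiency, `#{i : deg i < 12} + 2·C(x) ≤ 12·N`. -/
theorem defectDensity_le {N : ℕ} {x : Fin N → EuclideanSpace ℝ (Fin 3)} (hx : IsUnitPacking x) :
    (univ.filter fun i => coordination x i < 12).card + 2 * numContacts x ≤ 12 * N := by
  classical
  rw [← sum_coordination_eq x, Finset.card_filter, ← Finset.sum_add_distrib]
  have h : ∀ i, (if coordination x i < 12 then 1 else 0) + coordination x i ≤ 12 := fun i => by
    have := coordination_le_twelve hx i
    split_ifs <;> omega
  calc ∑ i, ((if coordination x i < 12 then 1 else 0) + coordination x i)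
      ≤ ∑ _i : Fin N, 12 := Finset.sum_le_sum fun i _ => h i
    _ = 12 * N := by simp [mul_comm]

/-- Real-valued form, against the deficiency `6N − C(x)`:
`#{i : deg i < 12} ≤ 2·(6N − C(x))`. -/
theorem defectDensity_le_real {N : ℕ} {x : Fin N → EuclideanSpace ℝ (Fin 3)}
    (hx : IsUnitPacking x) :
    ((univ.filter fun i => coordination x i < 12).card : ℝ) ≤
      2 * (6 * (N : ℝ) - (numContacts x : ℝ)) := by
  classical
  have h := defectDensity_le hx
  have h' : ((univ.filter fun i => coordination x i < 12).card : ℝ) + 2 * (numContacts x : ℝ) ≤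
      12 * (N : ℝ) := by
    exact_mod_cast h
  linarith

end Summit.Ventures.Crystal3D
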